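import Summits.ResolutionOfSingularities.ResolutionOfSingularities.Theorems.WeightedInvariantTieFiniteReduction
import Literature.AlgebraicGeometry.Resolution.AlterationsSemiStableCodimTwo
import Literature.AlgebraicGeometry.Resolution.RegularLocalRingsQuotient
import Mathlib.RingTheory.Nakayama
import HarnessLib

/-!
# Finiteness of the tie points, the curve is one-dimensional: the points of `closure {η}` other than `η` are closed
# (threefold ambient), so the reduction needs only the in-chart finiteness — door `HypersurfaceCentreConstruction`
# (stmt-ResolutionOfSingularities-19897), route `WeightedInvariant`, P3 rung `KeyRungGrLE 3 p`

[OURS · L1 W4.3 · cell `res-hironaka`, HUMAN RULING D-0089] Helper file `--supports stmt-ResolutionOfSingularities-19897`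
(res-type-047, deliverable (D2) «FINITENESS OF THE TIE POINTS», res-L1-w43-plan-1 RULING gen 11 #5; sequel of
`…TieFiniteReduction`).  It removes the hypothesis «`closure {η} ∖ V` finite» from the per-curve Chevalley step when all local
rings of `Y` have Krull dimension `≤ 3` (the door setting): the curve generic point `η` of a tie point has `dim 𝒪_{Y,η} ≥ 2`
(the tie presentation `(x, y, z)` gives the chain of primes `0 < (x) < (x, y) = P₀` in `𝒪_{Y,z}`), so every other point of
`closure {η}` has a `3`-dimensional local ring and is therefore a closed point.  CANDIDATE DESIGN OBJECTS ONLY; nothing here is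
a statement of the manuscript under review (Hironaka 2017, [claim: Hironaka2017, status: under-review]); nothing is attributed to
its author; nothing here claims anything about resolution of singularities.  AI work, weaker than expert review.

## What is proved (def-free)

* §1 `isClosed_singleton_of_ringKrullDim_stalk_eq` — on a locally Noetherian scheme all of whose local rings have dimension
  `≤ d`, a point whose local ring has dimension `d` is a closed point (`ringKrullDim_stalk_lt_of_specializes`).
* §2 `maximalIdeal_ne_span_pair`, `IsTiePresentation.notMem_sq` / `.ne_zero_x` / `.notMem_span` — the tie presentation `(x, y, z)` is a minimal system of generators of `𝔪`
  (regular of dimension `3`): `x ≠ 0`, `x ∉ 𝔪²`, `y ∉ (x)`; `IsTiePosition.two_le_height` — `2 ≤ ht P₀`;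
  `IsTiePosition.two_le_ringKrullDim_localization` — `2 ≤ dim (𝒪_{Y,z})_{P₀}`.
* §3 `exists_curve_of_isTiePosition_closedPoints` — the curve of a tie point with the extra clause «every point of
  `closure {η}` other than `η` is a closed point» (threefold ambient); **`tiePoints_finite_of_curveFinite'`** — the reduction
  of `…TieFiniteReduction` re-run with that clause handed to the per-curve hypothesis, which now returns only
  `∃ V ∋ η open, ({tie z | η ⤳ z, ν z = ν η} ∩ V).Finite` (`closure {η} ∖ V` is finite by `finite_closure_diff_of_isOpen`).
-/

noncomputable section

set_option linter.dupNamespace false -- mandated namespace `Summit.<Summit>.<Problem>` of this single-conjunct summit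

open CategoryTheory AlgebraicGeometry TopologicalSpace IsLocalRing Topology
open Literature.AlgebraicGeometry.Resolution
open Summit.ResolutionOfSingularities.ResolutionOfSingularities.Theorems (ContactCylinder.topStratum ContactCylinder.topStratumPrime)

namespace Summit.ResolutionOfSingularities.ResolutionOfSingularities.Cruxes.HypersurfaceCentreConstruction.LocalEngine

namespace TieFinite

/-! ## §1 Points of top dimension are closed -/

section ClosedPoints

variable {X : Scheme.{0}}

/-- **A point whose local ring has the top dimension is a closed point**: on a locally Noetherian scheme with all local rings
of Krull dimension `≤ d`, a proper specialisation would have strictly larger dimension (`ringKrullDim_stalk_lt_of_specializes`).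
[folklore] -/
theorem isClosed_singleton_of_ringKrullDim_stalk_eq [IsLocallyNoetherian X] {d : WithBot ℕ∞}
    (hmax : ∀ y : X, ringKrullDim (X.presheaf.stalk y) ≤ d) {y : X} (hy : ringKrullDim (X.presheaf.stalk y) = d) :
    IsClosed ({y} : Set X) := by
  rw [← closure_subset_iff_isClosed]
  intro y' hy'
  by_contra hne
  have hspec : y ⤳ y' := specializes_iff_mem_closure.mpr hy'
  have hlt := ringKrullDim_stalk_lt_of_specializes hspec (fun h => hne (h ▸ rfl))
  rw [hy] at hlt
  exact absurd (hmax y') (not_le_of_gt hlt)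

end ClosedPoints

/-! ## §2 The tie presentation is a minimal system of generators; `ht P₀ ≥ 2` -/

section Height

variable {S : Type} [CommRing S]

/-- In a regular local ring of dimension `3`, a generating triple of `𝔪` cannot be shortened: `𝔪 ≠ (a, b)`. [folklore] -/
theorem maximalIdeal_ne_span_pair [IsRegularLocalRing S] (hdim : ringKrullDim S = 3) (a b : S) :
    maximalIdeal S ≠ Ideal.span {a, b} := by
  intro h
  have h3 : ((maximalIdeal S).spanFinrank : WithBot ℕ∞) = 3 := by
    rw [IsRegularLocalRing.spanFinrank_maximalIdeal (R := S), hdim]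
  have hle : (maximalIdeal S).spanFinrank ≤ 2 := by
    rw [h]
    refine (Submodule.spanFinrank_span_le_ncard_of_finite (Set.toFinite _)).trans ?_
    calc ({a, b} : Set S).ncard ≤ ({b} : Set S).ncard + 1 := Set.ncard_insert_le a {b}
      _ = 2 := by rw [Set.ncard_singleton]
  have h3' : (maximalIdeal S).spanFinrank = 3 := by exact_mod_cast h3
  omega

variable {f x y z : S} {q r : ℕ} {lam : S}

/-- From a tie presentation in a regular local ring of dimension `3`: `x ∉ 𝔪²` (Nakayama: else `𝔪 = (y, z)`). [OURS] -/
theorem IsTiePresentation.notMem_sq [IsRegularLocalRing S] (hdim : ringKrullDim S = 3)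
    (h : Iota3.IsTiePresentation S f x y z q r lam) : x ∉ maximalIdeal S ^ 2 := by
  obtain ⟨hspan, -⟩ := h
  intro hx
  apply maximalIdeal_ne_span_pair hdim y z
  apply le_antisymm
  · -- Nakayama: `𝔪 ≤ (y, z) ⊔ 𝔪 • 𝔪`
    refine Submodule.le_of_le_smul_of_le_jacobson_bot (IsNoetherian.noetherian _)
      (IsLocalRing.maximalIdeal_le_jacobson ⊥) ?_
    have hle : Ideal.span {x, y, z} ≤ Ideal.span {y, z} ⊔ maximalIdeal S • maximalIdeal S := by
      refine Ideal.span_le.mpr ?_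
      rintro a (rfl | rfl | ha)
      · refine Ideal.mem_sup_right ?_
        rw [smul_eq_mul, ← pow_two]; exact hx
      · exact Ideal.mem_sup_left (Ideal.subset_span (Set.mem_insert _ _))
      · rw [Set.mem_singleton_iff] at ha
        rw [ha]
        exact Ideal.mem_sup_left (Ideal.subset_span (Set.mem_insert_of_mem _ rfl))
    rw [hspan] at hle
    exact hle
  · rw [← hspan]
    exact Ideal.span_mono (Set.subset_insert _ _)

/-- From a tie presentation in a regular local ring of dimension `3`: `x ≠ 0`. [OURS] -/
theorem IsTiePresentation.ne_zero_x [IsRegularLocalRing S] (hdim : ringKrullDim S = 3)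
    (h : Iota3.IsTiePresentation S f x y z q r lam) : x ≠ 0 := by
  intro hx
  exact IsTiePresentation.notMem_sq hdim h (hx ▸ Ideal.zero_mem _)

/-- From a tie presentation in a regular local ring of dimension `3`: `y ∉ (x)` (else `𝔪 = (x, z)`). [OURS] -/
theorem IsTiePresentation.notMem_span [IsRegularLocalRing S] (hdim : ringKrullDim S = 3)
    (h : Iota3.IsTiePresentation S f x y z q r lam) : y ∉ Ideal.span {x} := by
  obtain ⟨hspan, -⟩ := h
  intro hy
  apply maximalIdeal_ne_span_pair hdim x z
  apply le_antisymm
  · rw [← hspan]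
    refine Ideal.span_le.mpr ?_
    rintro a (rfl | rfl | ha)
    · exact Ideal.subset_span (Set.mem_insert _ _)
    · exact Ideal.span_mono (Set.singleton_subset_iff.mpr (Set.mem_insert _ _)) hy
    · rw [Set.mem_singleton_iff] at ha
      rw [ha]; exact Ideal.subset_span (Set.mem_insert_of_mem _ rfl)
  · rw [← hspan]
    refine Ideal.span_mono ?_
    intro a ha
    rcases ha with rfl | rfl
    · exact Set.mem_insert _ _
    · exact Set.mem_insert_of_mem _ (Set.mem_insert_of_mem _ rfl)

/-- **`ht P₀ ≥ 2`** for the stratum prime `P₀ = (x, y)` of a tie position: the chain `0 < (x) < (x, y)` of primes (`S/(x)` is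
regular, hence a domain, as `x ∉ 𝔪²`). [OURS] -/
theorem IsTiePosition.two_le_height {g : S} (hz : Iota3.IsTiePosition S g) :
    ∃ _ : IsRegularLocalRing S, (2 : ℕ∞) ≤ (ContactCylinder.topStratumPrime Iota3.iotaOrdEps S g).height := by
  obtain ⟨hreg, hdim, -, -, x, y, z, q, r, lam, hpres⟩ := hz
  refine ⟨hreg, ?_⟩
  have hP₀ : ContactCylinder.topStratumPrime Iota3.iotaOrdEps S g = Ideal.span {x, y} := hpres.2.1
  obtain ⟨ν, hP, -⟩ := hpres.2.2
  have hx0 : x ≠ 0 := IsTiePresentation.ne_zero_x hdim hpres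
  have hx2 : x ∉ maximalIdeal S ^ 2 := IsTiePresentation.notMem_sq hdim hpres
  have hxm : x ∈ maximalIdeal S := by
    rw [← hpres.1]; exact Ideal.subset_span (Set.mem_insert _ _)
  have hyx : y ∉ Ideal.span {x} := IsTiePresentation.notMem_span hdim hpres
  -- `(x)` is prime: `S/(x)` regular, hence a domain
  haveI hxreg : IsRegularLocalRing (S ⧸ Ideal.span {x}) := (IsRegularLocalRing.quotient_span_singleton hxm hx2).1
  haveI : IsDomain (S ⧸ Ideal.span {x}) := isDomain_of_isRegularLocalRing _
  haveI hxprime : (Ideal.span {x} : Ideal S).IsPrime := (Ideal.Quotient.isDomain_iff_prime _).mp inferInstance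
  haveI : IsDomain S := isDomain_of_isRegularLocalRing S
  -- the chain `⊥ < (x) < (x, y)`
  have h01 : (⊥ : Ideal S) < Ideal.span {x} := bot_lt_iff_ne_bot.mpr (by rwa [Ne, Ideal.span_singleton_eq_bot])
  have h12 : Ideal.span {x} < Ideal.span {x, y} := by
    refine lt_of_le_of_ne (Ideal.span_mono (Set.singleton_subset_iff.mpr (Set.mem_insert _ _))) fun h => hyx ?_
    rw [h]; exact Ideal.subset_span (Set.mem_insert_of_mem _ rfl)
  haveI : (Ideal.span ({x, y} : Set S)).IsPrime := hP
  have hh1 : (⊥ : Ideal S).height < (Ideal.span {x} : Ideal S).height :=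
    Ideal.height_strict_mono_of_isPrime_of_isPrime h01
  have hh2 : (Ideal.span {x} : Ideal S).height < (Ideal.span ({x, y} : Set S)).height :=
    Ideal.height_strict_mono_of_isPrime_of_isPrime h12
  rw [hP₀]
  have hbot : (⊥ : Ideal S).height ≠ ⊤ := Ideal.height_ne_top (by simp)
  have hxt : (Ideal.span {x} : Ideal S).height ≠ ⊤ := Ideal.height_ne_top (Ideal.IsPrime.ne_top hxprime)
  have h1 : (1 : ℕ∞) ≤ (Ideal.span {x} : Ideal S).height := by
    have := (ENat.add_one_le_iff hbot).mpr hh1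
    exact le_trans (by simp) this
  have h2 : (Ideal.span {x} : Ideal S).height + 1 ≤ (Ideal.span ({x, y} : Set S)).height :=
    (ENat.add_one_le_iff hxt).mpr hh2
  calc (2 : ℕ∞) = 1 + 1 := by norm_num
    _ ≤ (Ideal.span {x} : Ideal S).height + 1 := add_le_add h1 le_rfl
    _ ≤ _ := h2

/-- **`dim (𝒪_{Y,z})_{P₀} ≥ 2`** at a tie position. [OURS] -/
theorem IsTiePosition.two_le_ringKrullDim_localization {g : S} (hz : Iota3.IsTiePosition S g)
    [(ContactCylinder.topStratumPrime Iota3.iotaOrdEps S g).IsPrime] :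
    (2 : WithBot ℕ∞) ≤ ringKrullDim (Localization.AtPrime (ContactCylinder.topStratumPrime Iota3.iotaOrdEps S g)) := by
  obtain ⟨_, h2⟩ := IsTiePosition.two_le_height hz
  rw [IsLocalization.AtPrime.ringKrullDim_eq_height (ContactCylinder.topStratumPrime Iota3.iotaOrdEps S g)]
  exact (WithBot.coe_le_coe.mpr h2 : ((2 : ℕ∞) : WithBot ℕ∞) ≤ _)

end Height

/-! ## §3 The curve of a tie point in a threefold: all its other points are closed; the lighter reduction -/

section Reduction

variable {k₀ : Type} [Field k₀] {Y : Scheme.{0}} (hY : Y ⟶ Spec (CommRingCat.of k₀)) [Smooth hY] [QuasiCompact hY]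

/-- **The curve of a tie point, threefold ambient.**  As `exists_curve_of_isTiePosition`, with the extra clause: every point of
`closure {η}` other than `η` is a CLOSED point (`dim 𝒪_{Y,η} ≥ 2`, all dimensions `≤ 3`). [OURS] -/
theorem exists_curve_of_isTiePosition_closedPoints [IsLocallyNoetherian Y]
    (hdim3 : ∀ y : Y, ringKrullDim (Y.presheaf.stalk y) ≤ 3) (f : Γ(Y, ⊤)) {z : Y}
    (hz : Iota3.IsTiePosition (Y.presheaf.stalk z) ((Y.presheaf.germ ⊤ z trivial) f)) :
    ∃ (η : Y) (n : ℕ), η ⤳ z ∧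
      iotaOrd (Y.presheaf.stalk z) ((Y.presheaf.germ ⊤ z trivial) f) = n ∧
      iotaOrd (Y.presheaf.stalk η) ((Y.presheaf.germ ⊤ η trivial) f) = n ∧
      (∀ θ : Y, θ ⤳ η → θ ≠ η → iotaOrd (Y.presheaf.stalk θ) ((Y.presheaf.germ ⊤ θ trivial) f) < n) ∧
      ∀ y ∈ closure ({η} : Set Y), y ≠ η → IsClosed ({y} : Set Y) := by
  obtain ⟨ν, hP₀, hνeq, hνP₀, hdrop⟩ := IsTiePosition.iotaOrd_localization_lt hz
  haveI := hP₀
  have h2 := IsTiePosition.two_le_ringKrullDim_localization hz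
  obtain ⟨η, hηz, htrans, hgen⟩ := exists_generization_of_prime f z ⟨_, hP₀⟩
  have hνη : iotaOrd (Y.presheaf.stalk η) ((Y.presheaf.germ ⊤ η trivial) f) = ν :=
    (htrans (fun R _ g => iotaOrd R g = ν) (fun R T _ _ e g => by rw [iotaOrd_isoInvariant R T e g])).mp hνP₀
  have hdimη : (2 : WithBot ℕ∞) ≤ ringKrullDim (Y.presheaf.stalk η) :=
    (htrans (fun R _ _ => (2 : WithBot ℕ∞) ≤ ringKrullDim R)
      (fun R T _ _ e _ => by rw [ringKrullDim_eq_of_ringEquiv e])).mp h2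
  refine ⟨η, ν, hηz, hνeq, hνη, fun θ hθη hne => ?_, fun y hy hne => ?_⟩
  · obtain ⟨𝔮, h𝔮lt, htransθ⟩ := hgen θ hθη hne
    have hnotle : ¬ ContactCylinder.topStratumPrime Iota3.iotaOrdEps _ _ ≤ 𝔮.asIdeal :=
      fun hle => (lt_irrefl _) (lt_of_lt_of_le h𝔮lt hle)
    have hν𝔮 := hdrop 𝔮.asIdeal hnotle
    have hθm : iotaOrd (Y.presheaf.stalk θ) ((Y.presheaf.germ ⊤ θ trivial) f) =
        iotaOrd (Localization.AtPrime 𝔮.asIdeal) (algebraMap _ (Localization.AtPrime 𝔮.asIdeal)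
          ((Y.presheaf.germ ⊤ z trivial) f)) :=
      (htransθ (fun R _ g => iotaOrd R g = iotaOrd (Localization.AtPrime 𝔮.asIdeal)
          (algebraMap _ (Localization.AtPrime 𝔮.asIdeal) ((Y.presheaf.germ ⊤ z trivial) f)))
        (fun R T _ _ e g => by rw [iotaOrd_isoInvariant R T e g])).mp rfl
    rw [hθm]
    exact hν𝔮
  · -- `η ⤳ y`, `y ≠ η`: `dim 𝒪_y > dim 𝒪_η ≥ 2`, so `dim 𝒪_y = 3`, and `y` is closed
    have hspec : η ⤳ y := specializes_iff_mem_closure.mpr hy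
    have hlt := ringKrullDim_stalk_lt_of_specializes hspec (Ne.symm hne)
    obtain ⟨m, hm⟩ := exists_nat_cast_eq_ringKrullDim (R := Y.presheaf.stalk y)
    obtain ⟨m', hm'⟩ := exists_nat_cast_eq_ringKrullDim (R := Y.presheaf.stalk η)
    have h3 : ringKrullDim (Y.presheaf.stalk y) = 3 := by
      have hle := hdim3 y
      rw [hm] at hle hlt ⊢
      rw [hm'] at hlt hdimη
      have h2' : 2 ≤ m' := by exact_mod_cast hdimη
      have hlt' : m' < m := by exact_mod_cast hlt
      have hle' : m ≤ 3 := by exact_mod_cast hle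
      have : m = 3 := by omega
      rw [this]; rfl
    exact isClosed_singleton_of_ringKrullDim_stalk_eq hdim3 h3

include hY in
/-- **Tie points are finite as soon as they are finite in a neighbourhood of each curve generic point** (threefold ambient:
all local rings of dimension `≤ 3`).  The per-curve hypothesis receives, besides the maximality of `η` in `{n ≤ ν}` and a tie
point of order `n` below `η`, the fact that every point of `closure {η}` other than `η` is CLOSED, and must return only an
open `V ∋ η` on which the tie points `z` with `η ⤳ z`, `ν z = n` are finitely many (`closure {η} ∖ V` is then finite by
`finite_closure_diff_of_isOpen`). [OURS] -/
theorem tiePoints_finite_of_curveFinite' (hdim3 : ∀ y : Y, ringKrullDim (Y.presheaf.stalk y) ≤ 3) (f : Γ(Y, ⊤))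
    (hcurve : ∀ (η : Y) (n : ℕ), iotaOrd (Y.presheaf.stalk η) ((Y.presheaf.germ ⊤ η trivial) f) = n →
      (∀ θ : Y, θ ⤳ η → θ ≠ η → iotaOrd (Y.presheaf.stalk θ) ((Y.presheaf.germ ⊤ θ trivial) f) < n) →
      (∃ z : Y, Iota3.IsTiePosition (Y.presheaf.stalk z) ((Y.presheaf.germ ⊤ z trivial) f) ∧ η ⤳ z ∧
        iotaOrd (Y.presheaf.stalk z) ((Y.presheaf.germ ⊤ z trivial) f) = n) →
      (∀ y ∈ closure ({η} : Set Y), y ≠ η → IsClosed ({y} : Set Y)) →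
      ∃ V : Set Y, IsOpen V ∧ η ∈ V ∧
        ({z : Y | Iota3.IsTiePosition (Y.presheaf.stalk z) ((Y.presheaf.germ ⊤ z trivial) f) ∧ η ⤳ z ∧
            iotaOrd (Y.presheaf.stalk z) ((Y.presheaf.germ ⊤ z trivial) f) = n} ∩ V).Finite) :
    {z : Y | Iota3.IsTiePosition (Y.presheaf.stalk z) ((Y.presheaf.germ ⊤ z trivial) f)}.Finite := by
  classical
  haveI : NoetherianSpace Y := Theorems.noetherianSpace_of_smooth_quasiCompact hY
  haveI : IsLocallyNoetherian Y := LocallyOfFiniteType.isLocallyNoetherian hY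
  set T : Set Y := {z : Y | Iota3.IsTiePosition (Y.presheaf.stalk z) ((Y.presheaf.germ ⊤ z trivial) f)} with hTdef
  set nu : Y → Ordinal.{0} := fun y => iotaOrd (Y.presheaf.stalk y) ((Y.presheaf.germ ⊤ y trivial) f) with hnudef
  have hFclosed : ∀ n : ℕ, IsClosed {y : Y | (n : Ordinal.{0}) ≤ nu y} := fun n =>
    iotaOrd_upperSemicontinuous k₀ Y hY f n
  -- curve generic points WITH the closed-points property
  set H : Set Y := {η : Y | ∃ n : ℕ, nu η = n ∧ (∀ θ : Y, θ ⤳ η → θ ≠ η → nu θ < n) ∧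
    (∃ z : Y, z ∈ T ∧ η ⤳ z ∧ nu z = n) ∧ ∀ y ∈ closure ({η} : Set Y), y ≠ η → IsClosed ({y} : Set Y)} with hHdef
  have hTH : T ⊆ ⋃ η ∈ H, {z : Y | z ∈ T ∧ η ⤳ z ∧ nu z = nu η} := by
    intro z hz
    obtain ⟨η, n, hηz, hνz, hνη, hmax, hcl⟩ := exists_curve_of_isTiePosition_closedPoints hdim3 f hz
    refine Set.mem_iUnion₂.mpr ⟨η, ⟨n, hνη, hmax, ⟨z, hz, hηz, hνz⟩, hcl⟩, hz, hηz, ?_⟩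
    exact hνz.trans hνη.symm
  have hHfin : H.Finite := by
    obtain ⟨N, hN⟩ := exists_forall_eq_of_antitone_closeds (X := Y) (fun n : ℕ => {y : Y | (n : Ordinal.{0}) ≤ nu y})
      hFclosed (fun n y hy => by
        have hy' : ((n + 1 : ℕ) : Ordinal.{0}) ≤ nu y := hy
        exact le_trans (by exact_mod_cast Nat.le_succ n) hy')
    have hval : ∀ η ∈ H, ∃ n : ℕ, n < N + 1 ∧ nu η = n ∧ ∀ θ : Y, θ ⤳ η → θ ≠ η → nu θ < n := by
      rintro η ⟨n, hn, hmax, -, -⟩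
      refine ⟨n, ?_, hn, hmax⟩
      by_contra hge
      have hNn : N ≤ n := by omega
      have h1 : η ∈ {y : Y | ((n : ℕ) : Ordinal.{0}) ≤ nu y} := by
        change ((n : ℕ) : Ordinal.{0}) ≤ nu η; rw [hn]
      rw [hN n hNn, ← hN (n + 1) (by omega)] at h1
      have h3 : ((n + 1 : ℕ) : Ordinal.{0}) ≤ nu η := h1
      rw [hn] at h3
      have h4 : n + 1 ≤ n := by exact_mod_cast h3
      omega
    refine Set.Finite.subset (Set.Finite.biUnion (Set.finite_lt_nat (N + 1)) fun n _ =>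
      finite_setOf_isMaximalIn (X := Y) (hFclosed n)) ?_
    intro η hη
    obtain ⟨n, hnN, hn, hmax⟩ := hval η hη
    refine Set.mem_biUnion hnN ⟨?_, fun θ hθ hθη => ?_⟩
    · change ((n : ℕ) : Ordinal.{0}) ≤ nu η; rw [hn]
    · by_contra hne
      have hlt := hmax θ hθη hne
      exact absurd hθ (not_le_of_gt hlt)
  refine (hHfin.biUnion fun η hη => ?_).subset hTH
  obtain ⟨n, hn, hmax, ⟨z, hzT, hηz, hνz⟩, hcl⟩ := hη
  obtain ⟨V, hVo, hηV, hfin⟩ := hcurve η n hn hmax ⟨z, hzT, hηz, hνz⟩ hcl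
  have hdiff := finite_closure_diff_of_isOpen hVo hηV hcl
  refine (hfin.union hdiff).subset ?_
  rintro t ⟨htT, htη, hνt⟩
  have hνt' : nu t = n := by rw [hνt]; exact hn
  by_cases htV : t ∈ V
  · exact Or.inl ⟨⟨htT, htη, hνt'⟩, htV⟩
  · exact Or.inr ⟨specializes_iff_mem_closure.mp htη, htV⟩

end Reduction

end TieFinite

end Summit.ResolutionOfSingularities.ResolutionOfSingularities.Cruxes.HypersurfaceCentreConstruction.LocalEngine

end
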